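import Summits.Ventures.LatticeQCDFlow.Scoring.UNFluxSectors
import Summits.Ventures.LatticeQCDFlow.Scoring.UNOnePlaquetteCumulants
import Literature.RepresentationTheory.CompactGroups.UnitaryGroupCharacters
import Mathlib.NumberTheory.ZetaValues
import Mathlib.Analysis.SpecialFunctions.Complex.Arg
import Mathlib.MeasureTheory.Function.SpecialFunctions.Basic
import HarnessLib

/-!
# The second moment of the 2-d `U(N)` topological density in closed form, every `N`, every `β`: `⟨q_p²⟩_β = 1/12 + π⁻² Σ_{n≥1} (−1)ⁿ det[I_{|i−j+n|}(β)] / (n² det[I_{|i−j|}(β)])`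

HONEST FRAMING: exact (Metropolis-corrected) sampling algorithms for lattice gauge theory;
figures of merit are autocorrelation/cost numbers at stated couplings and volumes; no
continuum-physics claim.

Venture `LatticeQCDFlow` (cell pub-lqcd), sub-topic `Scoring`; FANOUT row 5 (`s0-sun-a`), GEN-20.
NEW WORK of the cell (placement rule).  GEN-17's `UNFluxSectors` computed the `U(1)` flux sectors of the `U(N)` one-plaquette
law, `∫_{U(N)} (det U)^q e^{x Re tr U} dU = det[I_{|i−j+q|}(x)]`, i.e. the Fourier coefficients of the law of the topological
angle `θ_p = arg det U_p`.  With the Fourier series of the second Bernoulli polynomial (Mathlib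
`hasSum_one_div_nat_pow_mul_cos`: `Σ_n cos(2πny)/n² = π² B₂(y)` on `[0,1]`) at `y = θ/(2π) + ½`:

* §1 **`sq_div_two_pi_eq_tsum`** — for `θ ∈ (−π, π]`: `(θ/2π)² = 1/12 + π⁻² Σ_{n≥1} (−1)ⁿ cos(nθ)/n²` (absolutely convergent);
* §2 `cos_nat_mul_arg_eq_re_pow` (`cos(n·arg z) = Re zⁿ` on the unit circle), **`integral_cos_mul_arg_det_mul_exp`** —
  `∫_{U(N)} cos(n·arg det U) e^{β Re tr U} dU = det[I_{|i−j+n|}(β)]`;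
* §3 **`unitary_topDensity_sq_eq_tsum`** — under the `U(N)` one-plaquette (= 2-d infinite-volume) law at every real `β`,
  `⟨(arg det U_p/2π)²⟩_β = 1/12 + π⁻² Σ_{n≥1} (−1)ⁿ det[I_{|i−j+n|}(β)] / (n² det[I_{|i−j|}(β)])`
  (termwise integration, `integral_tsum_of_summable_integral_norm`): the every-`N` form of row 5's `U(1)` closed form
  `χ_∞(β) = 1/12 + …` (`U1TorusTopologicalSusceptibility*`); the sum is written over `n : ℕ` with the `n = 0` term `= 0`;
* §4 `besselI_apply_zero_of_ne_zero` (`I_n(0) = 0`, `n ≥ 1`), `det_besselI_toeplitz_shift_zero`, **`unitary_topDensity_sq_zero`** —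
  at `β = 0` (Haar measure) `⟨q_p²⟩_0 = 1/12`: the topological angle is uniform; with `UNDeterminantPhaseWeakCoupling`
  (`4π²β⟨q_p²⟩_β → N`) the two ends of the coupling range are exact.

No `def`, nothing cited as a fact, 0 sorry.
-/

noncomputable section

open Real MeasureTheory Filter Topology Finset
open Complex (I)
open Literature.MathematicalPhysics.QuantumFieldTheory (haarProbability)
open Literature.Analysis.FunctionSpaces (besselI)
open Literature.RepresentationTheory.CompactGroups

namespace Summit.Ventures.LatticeQCDFlow.Scoring

/-! ### 1. The Fourier series of `(θ/2π)²` on `(−π, π]` -/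

/-- **`(θ/2π)² = 1/12 + π⁻² Σ_n (−1)ⁿ cos(nθ)/n²`** for `θ ∈ (−π, π]` (the `n = 0` term vanishes: `1/0 = 0`). -/
theorem hasSum_sq_div_two_pi {θ : ℝ} (hθ : θ ∈ Set.Ioc (-π) π) :
    HasSum (fun n : ℕ => 1 / π ^ 2 * ((-1 : ℝ) ^ n / (n : ℝ) ^ 2 * Real.cos (n * θ)))
      ((θ / (2 * π)) ^ 2 - 1 / 12) := by
  have hπ : 0 < π := Real.pi_pos
  set y : ℝ := θ / (2 * π) + 1 / 2 with hy
  have hy01 : y ∈ Set.Icc (0 : ℝ) 1 := by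
    constructor
    · rw [hy]
      have : -π / (2 * π) ≤ θ / (2 * π) := div_le_div_of_nonneg_right hθ.1.le (by positivity)
      have e : -π / (2 * π) = -(1 / 2) := by field_simp
      linarith
    · rw [hy]
      have : θ / (2 * π) ≤ π / (2 * π) := div_le_div_of_nonneg_right hθ.2 (by positivity)
      have e : π / (2 * π) = 1 / 2 := by field_simp
      linarith
  have h := hasSum_one_div_nat_pow_mul_cos one_ne_zero hy01
  have hB : (Polynomial.map (algebraMap ℚ ℝ) (Polynomial.bernoulli (2 * 1))).eval y = y ^ 2 - y + 6⁻¹ := by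
    have := bernoulliFun_two y
    simpa [bernoulliFun] using this
  rw [hB] at h
  -- rewrite `cos(2πny)` as `(−1)ⁿ cos(nθ)`
  have hcos : ∀ n : ℕ, Real.cos (2 * π * n * y) = (-1 : ℝ) ^ n * Real.cos (n * θ) := by
    intro n
    rw [hy, show 2 * π * n * (θ / (2 * π) + 1 / 2) = n * θ + n * π by field_simp]
    exact Real.cos_add_nat_mul_pi _ _
  simp_rw [hcos] at h
  have h2 := h.div_const (π ^ 2)
  have hval : (-1 : ℝ) ^ (1 + 1) * (2 * π) ^ (2 * 1) / 2 / (2 * 1).factorial * (y ^ 2 - y + 6⁻¹) / π ^ 2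
      = (θ / (2 * π)) ^ 2 - 1 / 12 := by
    rw [hy]
    norm_num [Nat.factorial]
    try field_simp
    try ring
  rw [hval] at h2
  have h3 : (fun n : ℕ => 1 / π ^ 2 * ((-1 : ℝ) ^ n / (n : ℝ) ^ 2 * Real.cos (n * θ)))
      = fun i : ℕ => 1 / (i : ℝ) ^ (2 * 1) * ((-1 : ℝ) ^ i * Real.cos (i * θ)) / π ^ 2 := by
    funext n; ring
  rw [h3]
  exact h2

/-- The series of §1 as a `tsum` identity. -/
theorem sq_div_two_pi_eq_tsum {θ : ℝ} (hθ : θ ∈ Set.Ioc (-π) π) :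
    (θ / (2 * π)) ^ 2 = 1 / 12 + ∑' n : ℕ, 1 / π ^ 2 * ((-1 : ℝ) ^ n / (n : ℝ) ^ 2 * Real.cos (n * θ)) := by
  rw [(hasSum_sq_div_two_pi hθ).tsum_eq]
  ring

/-! ### 2. The Fourier coefficients of the topological angle: flux sectors -/

/-- On the unit circle `cos(n · arg z) = Re zⁿ`. -/
theorem cos_nat_mul_arg_eq_re_pow {z : ℂ} (hz : ‖z‖ = 1) (n : ℕ) :
    Real.cos (n * Complex.arg z) = (z ^ n).re := by
  have hz1 : z = Complex.exp (Complex.arg z * I) := by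
    have h := Complex.norm_mul_exp_arg_mul_I z
    rw [hz, Complex.ofReal_one, one_mul] at h
    exact h.symm
  conv_rhs => rw [hz1, ← Complex.exp_nat_mul, show (n : ℂ) * (Complex.arg z * I) = ((n * Complex.arg z : ℝ) : ℂ) * I by
    push_cast; ring, Complex.exp_ofReal_mul_I_re]

/-- `u ↦ cos(n · arg det u) e^{β Re tr u}` is integrable on `U(N)` (measurable and bounded). -/
theorem integrable_cos_mul_arg_det_mul_exp (N : ℕ) (β : ℝ) (n : ℕ) :
    Integrable (fun u : Matrix.unitaryGroup (Fin N) ℂ => Real.cos (n * Complex.arg ((u : Matrix.unitaryGroup (Fin N) ℂ) : Matrix (Fin N) (Fin N) ℂ).det) * Real.exp (β * ((u : Matrix.unitaryGroup (Fin N) ℂ) : Matrix (Fin N) (Fin N) ℂ).trace.re)) (haarProbability (Matrix.unitaryGroup (Fin N) ℂ)) := by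
  have hdet : Continuous fun u : Matrix.unitaryGroup (Fin N) ℂ => ((u : Matrix.unitaryGroup (Fin N) ℂ) : Matrix (Fin N) (Fin N) ℂ).det :=
    continuous_id.matrix_det.comp continuous_subtype_val
  have htr : Continuous fun u : Matrix.unitaryGroup (Fin N) ℂ => ((u : Matrix.unitaryGroup (Fin N) ℂ) : Matrix (Fin N) (Fin N) ℂ).trace.re :=
    Complex.continuous_re.comp (continuous_id.matrix_trace.comp continuous_subtype_val)
  have hm : AEStronglyMeasurable (fun u : Matrix.unitaryGroup (Fin N) ℂ => Real.cos (n * Complex.arg ((u : Matrix.unitaryGroup (Fin N) ℂ) : Matrix (Fin N) (Fin N) ℂ).det) * Real.exp (β * ((u : Matrix.unitaryGroup (Fin N) ℂ) : Matrix (Fin N) (Fin N) ℂ).trace.re)) (haarProbability (Matrix.unitaryGroup (Fin N) ℂ)) :=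
    ((Real.continuous_cos.measurable.comp (measurable_const.mul (Complex.measurable_arg.comp hdet.measurable))).mul
      (Real.continuous_exp.comp (continuous_const.mul htr)).measurable).aestronglyMeasurable
  refine Integrable.mono' (integrable_const (Real.exp (|β| * N))) hm (Eventually.of_forall fun u => ?_)
  rw [Real.norm_eq_abs, abs_mul, abs_of_nonneg (Real.exp_nonneg _)]
  have hb : |((u : Matrix.unitaryGroup (Fin N) ℂ) : Matrix (Fin N) (Fin N) ℂ).trace.re| ≤ N := by
    have h := abs_trace_re_le_card u
    rwa [Fintype.card_fin] at h
  calc |Real.cos (n * Complex.arg ((u : Matrix.unitaryGroup (Fin N) ℂ) : Matrix (Fin N) (Fin N) ℂ).det)| * Real.exp (β * ((u : Matrix.unitaryGroup (Fin N) ℂ) : Matrix (Fin N) (Fin N) ℂ).trace.re) ≤ 1 * Real.exp (|β| * N) :=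
        mul_le_mul (Real.abs_cos_le_one _) (Real.exp_le_exp.2 (by
          calc β * ((u : Matrix.unitaryGroup (Fin N) ℂ) : Matrix (Fin N) (Fin N) ℂ).trace.re ≤ |β * ((u : Matrix.unitaryGroup (Fin N) ℂ) : Matrix (Fin N) (Fin N) ℂ).trace.re| := le_abs_self _
            _ = |β| * |((u : Matrix.unitaryGroup (Fin N) ℂ) : Matrix (Fin N) (Fin N) ℂ).trace.re| := abs_mul _ _
            _ ≤ |β| * N := mul_le_mul_of_nonneg_left hb (abs_nonneg _))) (Real.exp_nonneg _) zero_le_one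
    _ = Real.exp (|β| * N) := one_mul _

/-- **`∫_{U(N)} cos(n · arg det U) e^{β Re tr U} dU = det[I_{|i−j+n|}(β)]`** — the `n`-th flux sector (GEN-17 `UNFluxSectors`). -/
theorem integral_cos_mul_arg_det_mul_exp (N : ℕ) (β : ℝ) (n : ℕ) :
    ∫ u, Real.cos (n * Complex.arg ((u : Matrix.unitaryGroup (Fin N) ℂ) : Matrix (Fin N) (Fin N) ℂ).det) * Real.exp (β * ((u : Matrix.unitaryGroup (Fin N) ℂ) : Matrix (Fin N) (Fin N) ℂ).trace.re) ∂(haarProbability (Matrix.unitaryGroup (Fin N) ℂ)) = (Matrix.of fun i j : Fin N => besselI ((i : ℤ) - (j : ℤ) + (n : ℤ)).natAbs β).det := by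
  have hflux := integral_haar_unitaryGroup_fin_det_zpow_mul_exp N β (n : ℤ)
  simp only [zpow_natCast] at hflux
  have hpt : ∀ u : Matrix.unitaryGroup (Fin N) ℂ, Real.cos (n * Complex.arg ((u : Matrix.unitaryGroup (Fin N) ℂ) : Matrix (Fin N) (Fin N) ℂ).det) * Real.exp (β * ((u : Matrix.unitaryGroup (Fin N) ℂ) : Matrix (Fin N) (Fin N) ℂ).trace.re)
      = ((((u : Matrix.unitaryGroup (Fin N) ℂ) : Matrix (Fin N) (Fin N) ℂ).det) ^ n * (Real.exp (β * ((u : Matrix.unitaryGroup (Fin N) ℂ) : Matrix (Fin N) (Fin N) ℂ).trace.re) : ℂ)).re := by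
    intro u
    rw [Complex.re_mul_ofReal, cos_nat_mul_arg_eq_re_pow (UnitaryGroupChar.norm_det_eq_one u)]
  simp_rw [hpt]
  have hint : Integrable (fun u : Matrix.unitaryGroup (Fin N) ℂ => (((u : Matrix.unitaryGroup (Fin N) ℂ) : Matrix (Fin N) (Fin N) ℂ).det) ^ n * (Real.exp (β * ((u : Matrix.unitaryGroup (Fin N) ℂ) : Matrix (Fin N) (Fin N) ℂ).trace.re) : ℂ)) (haarProbability (Matrix.unitaryGroup (Fin N) ℂ)) := by
    have hc : Continuous fun u : Matrix.unitaryGroup (Fin N) ℂ => (((u : Matrix.unitaryGroup (Fin N) ℂ) : Matrix (Fin N) (Fin N) ℂ).det) ^ n * (Real.exp (β * ((u : Matrix.unitaryGroup (Fin N) ℂ) : Matrix (Fin N) (Fin N) ℂ).trace.re) : ℂ) :=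
      ((continuous_id.matrix_det.comp continuous_subtype_val).pow n).mul (Complex.continuous_ofReal.comp
        (Real.continuous_exp.comp (continuous_const.mul (Complex.continuous_re.comp
          (continuous_id.matrix_trace.comp continuous_subtype_val)))))
    exact hc.integrable_of_hasCompactSupport (HasCompactSupport.of_compactSpace _)
  have hre := integral_re hint
  simp only [RCLike.re_to_complex] at hre
  rw [hre, hflux, Complex.ofReal_re]

/-! ### 3. The closed form of `⟨q_p²⟩_β` -/

/-- **THE SECOND MOMENT OF THE 2-d `U(N)` TOPOLOGICAL DENSITY IN CLOSED FORM, EVERY `N`, EVERY REAL `β`**: under the `U(N)`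
one-plaquette law `∝ e^{−β(N − Re tr U)} dU`, with `q_p = arg det U_p / (2π) ∈ (−½, ½]`,
`⟨q_p²⟩_β = 1/12 + Σ_n π⁻² (−1)ⁿ n⁻² · det[I_{|i−j+n|}(β)] / det[I_{|i−j|}(β)]` (the `n = 0` term is `0`). -/
theorem unitary_topDensity_sq_eq_tsum (N : ℕ) (β : ℝ) :
    (∫ u, (Complex.arg ((u : Matrix.unitaryGroup (Fin N) ℂ) : Matrix (Fin N) (Fin N) ℂ).det / (2 * π)) ^ 2 * Real.exp (-(β * ((N : ℝ) - ((u : Matrix.unitaryGroup (Fin N) ℂ) : Matrix (Fin N) (Fin N) ℂ).trace.re))) ∂(haarProbability (Matrix.unitaryGroup (Fin N) ℂ))) / (∫ u, Real.exp (-(β * ((N : ℝ) - ((u : Matrix.unitaryGroup (Fin N) ℂ) : Matrix (Fin N) (Fin N) ℂ).trace.re))) ∂(haarProbability (Matrix.unitaryGroup (Fin N) ℂ)))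
      = 1 / 12 + ∑' n : ℕ, 1 / π ^ 2 * ((-1 : ℝ) ^ n / (n : ℝ) ^ 2 *
          ((Matrix.of fun i j : Fin N => besselI ((i : ℤ) - (j : ℤ) + (n : ℤ)).natAbs β).det / (Matrix.of fun i j : Fin N => besselI ((i : ℤ) - (j : ℤ)).natAbs β).det)) := by
  -- normalise the weights: `e^{−β(N − R)} = e^{−Nβ} e^{βR}`
  have hsplit : ∀ u : Matrix.unitaryGroup (Fin N) ℂ, Real.exp (-(β * ((N : ℝ) - ((u : Matrix.unitaryGroup (Fin N) ℂ) : Matrix (Fin N) (Fin N) ℂ).trace.re))) = Real.exp (-(N * β)) * Real.exp (β * ((u : Matrix.unitaryGroup (Fin N) ℂ) : Matrix (Fin N) (Fin N) ℂ).trace.re) := by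
    intro u; rw [← Real.exp_add]; congr 1; ring
  have hD := det_besselI_toeplitz_fin_pos N β
  have he : Real.exp (-(N * β)) ≠ 0 := (Real.exp_pos _).ne'
  -- the pointwise series, multiplied by the weight
  set F : ℕ → Matrix.unitaryGroup (Fin N) ℂ → ℝ := fun n u =>
    1 / π ^ 2 * ((-1 : ℝ) ^ n / (n : ℝ) ^ 2 * Real.cos (n * Complex.arg ((u : Matrix.unitaryGroup (Fin N) ℂ) : Matrix (Fin N) (Fin N) ℂ).det)) * Real.exp (β * ((u : Matrix.unitaryGroup (Fin N) ℂ) : Matrix (Fin N) (Fin N) ℂ).trace.re) with hF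
  have hpt : ∀ u : Matrix.unitaryGroup (Fin N) ℂ, (Complex.arg ((u : Matrix.unitaryGroup (Fin N) ℂ) : Matrix (Fin N) (Fin N) ℂ).det / (2 * π)) ^ 2 * Real.exp (β * ((u : Matrix.unitaryGroup (Fin N) ℂ) : Matrix (Fin N) (Fin N) ℂ).trace.re)
      = 1 / 12 * Real.exp (β * ((u : Matrix.unitaryGroup (Fin N) ℂ) : Matrix (Fin N) (Fin N) ℂ).trace.re) + ∑' n : ℕ, F n u := by
    intro u
    have hθ : Complex.arg ((u : Matrix.unitaryGroup (Fin N) ℂ) : Matrix (Fin N) (Fin N) ℂ).det ∈ Set.Ioc (-π) π := ⟨Complex.neg_pi_lt_arg _, Complex.arg_le_pi _⟩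
    rw [sq_div_two_pi_eq_tsum hθ, add_mul, ← tsum_mul_right]
  -- integrability and summability of the terms
  have hFint : ∀ n : ℕ, Integrable (F n) (haarProbability (Matrix.unitaryGroup (Fin N) ℂ)) := fun n => by
    have h := (integrable_cos_mul_arg_det_mul_exp N β n).const_mul (1 / π ^ 2 * ((-1 : ℝ) ^ n / (n : ℝ) ^ 2))
    refine h.congr (Eventually.of_forall fun u => ?_)
    simp only [hF]
    ring
  have hbd : ∀ n : ℕ, ∫ u, ‖F n u‖ ∂(haarProbability (Matrix.unitaryGroup (Fin N) ℂ)) ≤ (Real.exp (|β| * N) / π ^ 2) * (1 / (n : ℝ) ^ 2) := by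
    intro n
    have hb : ∀ u : Matrix.unitaryGroup (Fin N) ℂ, ‖F n u‖ ≤ (Real.exp (|β| * N) / π ^ 2) * (1 / (n : ℝ) ^ 2) := by
      intro u
      simp only [hF, Real.norm_eq_abs]
      have htr : |((u : Matrix.unitaryGroup (Fin N) ℂ) : Matrix (Fin N) (Fin N) ℂ).trace.re| ≤ N := by
        have h := abs_trace_re_le_card u
        rwa [Fintype.card_fin] at h
      have hE : Real.exp (β * ((u : Matrix.unitaryGroup (Fin N) ℂ) : Matrix (Fin N) (Fin N) ℂ).trace.re) ≤ Real.exp (|β| * N) := Real.exp_le_exp.2 (by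
        calc β * ((u : Matrix.unitaryGroup (Fin N) ℂ) : Matrix (Fin N) (Fin N) ℂ).trace.re ≤ |β * ((u : Matrix.unitaryGroup (Fin N) ℂ) : Matrix (Fin N) (Fin N) ℂ).trace.re| := le_abs_self _
          _ = |β| * |((u : Matrix.unitaryGroup (Fin N) ℂ) : Matrix (Fin N) (Fin N) ℂ).trace.re| := abs_mul _ _
          _ ≤ |β| * N := mul_le_mul_of_nonneg_left htr (abs_nonneg _))
      rw [abs_mul, abs_mul, abs_of_nonneg (Real.exp_nonneg _), abs_of_nonneg (by positivity : (0 : ℝ) ≤ 1 / π ^ 2)]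
      have habs : |(-1 : ℝ) ^ n / (n : ℝ) ^ 2 * Real.cos (n * Complex.arg ((u : Matrix.unitaryGroup (Fin N) ℂ) : Matrix (Fin N) (Fin N) ℂ).det)| ≤ 1 / (n : ℝ) ^ 2 := by
        rw [abs_mul, abs_div, abs_pow, abs_neg, abs_one, one_pow, abs_of_nonneg (by positivity : (0 : ℝ) ≤ (n : ℝ) ^ 2)]
        exact mul_le_of_le_one_right (by positivity) (Real.abs_cos_le_one _)
      calc 1 / π ^ 2 * |(-1 : ℝ) ^ n / (n : ℝ) ^ 2 * Real.cos (n * Complex.arg ((u : Matrix.unitaryGroup (Fin N) ℂ) : Matrix (Fin N) (Fin N) ℂ).det)| * Real.exp (β * ((u : Matrix.unitaryGroup (Fin N) ℂ) : Matrix (Fin N) (Fin N) ℂ).trace.re)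
          ≤ 1 / π ^ 2 * (1 / (n : ℝ) ^ 2) * Real.exp (|β| * N) :=
            mul_le_mul (mul_le_mul_of_nonneg_left habs (by positivity)) hE (Real.exp_nonneg _) (by positivity)
        _ = Real.exp (|β| * N) / π ^ 2 * (1 / (n : ℝ) ^ 2) := by ring
    calc ∫ u, ‖F n u‖ ∂(haarProbability (Matrix.unitaryGroup (Fin N) ℂ)) ≤ ∫ _u, (Real.exp (|β| * N) / π ^ 2) * (1 / (n : ℝ) ^ 2) ∂(haarProbability (Matrix.unitaryGroup (Fin N) ℂ)) :=
          integral_mono (hFint n).norm (integrable_const _) hb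
      _ = (Real.exp (|β| * N) / π ^ 2) * (1 / (n : ℝ) ^ 2) := by simp
  have hsum : Summable fun n : ℕ => ∫ u, ‖F n u‖ ∂(haarProbability (Matrix.unitaryGroup (Fin N) ℂ)) := by
    refine Summable.of_nonneg_of_le (fun n => integral_nonneg fun u => norm_nonneg _) hbd ?_
    exact (Real.summable_one_div_nat_pow.mpr one_lt_two).mul_left _
  -- termwise integration
  have hterm : ∀ n : ℕ, ∫ u, F n u ∂(haarProbability (Matrix.unitaryGroup (Fin N) ℂ)) = 1 / π ^ 2 * ((-1 : ℝ) ^ n / (n : ℝ) ^ 2) * (Matrix.of fun i j : Fin N => besselI ((i : ℤ) - (j : ℤ) + (n : ℤ)).natAbs β).det := by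
    intro n
    have e : ∀ u : Matrix.unitaryGroup (Fin N) ℂ, F n u = 1 / π ^ 2 * ((-1 : ℝ) ^ n / (n : ℝ) ^ 2) *
        (Real.cos (n * Complex.arg ((u : Matrix.unitaryGroup (Fin N) ℂ) : Matrix (Fin N) (Fin N) ℂ).det) * Real.exp (β * ((u : Matrix.unitaryGroup (Fin N) ℂ) : Matrix (Fin N) (Fin N) ℂ).trace.re)) := fun u => by simp only [hF]; ring
    simp_rw [e]
    rw [integral_const_mul, integral_cos_mul_arg_det_mul_exp]
  have hE_int : Integrable (fun u : Matrix.unitaryGroup (Fin N) ℂ => Real.exp (β * ((u : Matrix.unitaryGroup (Fin N) ℂ) : Matrix (Fin N) (Fin N) ℂ).trace.re)) (haarProbability (Matrix.unitaryGroup (Fin N) ℂ)) := by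
    have hc : Continuous fun u : Matrix.unitaryGroup (Fin N) ℂ => Real.exp (β * ((u : Matrix.unitaryGroup (Fin N) ℂ) : Matrix (Fin N) (Fin N) ℂ).trace.re) :=
      Real.continuous_exp.comp (continuous_const.mul (Complex.continuous_re.comp
        (continuous_id.matrix_trace.comp continuous_subtype_val)))
    exact hc.integrable_of_hasCompactSupport (HasCompactSupport.of_compactSpace _)
  have htsum_int : Integrable (fun u : Matrix.unitaryGroup (Fin N) ℂ => ∑' n : ℕ, F n u) (haarProbability (Matrix.unitaryGroup (Fin N) ℂ)) := by
    have h : (fun u : Matrix.unitaryGroup (Fin N) ℂ => ∑' n : ℕ, F n u)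
        = fun u => (Complex.arg ((u : Matrix.unitaryGroup (Fin N) ℂ) : Matrix (Fin N) (Fin N) ℂ).det / (2 * π)) ^ 2 * Real.exp (β * ((u : Matrix.unitaryGroup (Fin N) ℂ) : Matrix (Fin N) (Fin N) ℂ).trace.re) - 1 / 12 * Real.exp (β * ((u : Matrix.unitaryGroup (Fin N) ℂ) : Matrix (Fin N) (Fin N) ℂ).trace.re) := by
      funext u; rw [hpt u]; ring
    rw [h]
    refine Integrable.sub ?_ (hE_int.const_mul _)
    have hdet : Continuous fun u : Matrix.unitaryGroup (Fin N) ℂ => ((u : Matrix.unitaryGroup (Fin N) ℂ) : Matrix (Fin N) (Fin N) ℂ).det :=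
      continuous_id.matrix_det.comp continuous_subtype_val
    have hm : AEStronglyMeasurable (fun u : Matrix.unitaryGroup (Fin N) ℂ => (Complex.arg ((u : Matrix.unitaryGroup (Fin N) ℂ) : Matrix (Fin N) (Fin N) ℂ).det / (2 * π)) ^ 2 * Real.exp (β * ((u : Matrix.unitaryGroup (Fin N) ℂ) : Matrix (Fin N) (Fin N) ℂ).trace.re)) (haarProbability (Matrix.unitaryGroup (Fin N) ℂ)) :=
      (((Complex.measurable_arg.comp hdet.measurable).div_const _).pow_const 2).aestronglyMeasurable.mul hE_int.1
    refine Integrable.mono' (hE_int.const_mul ((π / (2 * π)) ^ 2)) hm (Eventually.of_forall fun u => ?_)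
    rw [Real.norm_eq_abs, abs_mul, abs_of_nonneg (sq_nonneg _), abs_of_nonneg (Real.exp_nonneg _)]
    refine mul_le_mul_of_nonneg_right ?_ (Real.exp_nonneg _)
    rw [div_pow, div_pow]
    refine div_le_div_of_nonneg_right ?_ (by positivity)
    rw [← sq_abs]
    exact pow_le_pow_left₀ (abs_nonneg _) (Complex.abs_arg_le_pi _) 2
  -- assemble
  simp_rw [hsplit]
  have h1 : ∀ u : Matrix.unitaryGroup (Fin N) ℂ, (Complex.arg ((u : Matrix.unitaryGroup (Fin N) ℂ) : Matrix (Fin N) (Fin N) ℂ).det / (2 * π)) ^ 2 * (Real.exp (-(N * β)) * Real.exp (β * ((u : Matrix.unitaryGroup (Fin N) ℂ) : Matrix (Fin N) (Fin N) ℂ).trace.re))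
      = Real.exp (-(N * β)) * ((Complex.arg ((u : Matrix.unitaryGroup (Fin N) ℂ) : Matrix (Fin N) (Fin N) ℂ).det / (2 * π)) ^ 2 * Real.exp (β * ((u : Matrix.unitaryGroup (Fin N) ℂ) : Matrix (Fin N) (Fin N) ℂ).trace.re)) := fun u => by ring
  simp_rw [h1, integral_const_mul]
  rw [integral_haar_unitaryGroup_fin_exp_mul_trace_re]
  simp_rw [hpt]
  rw [integral_add (hE_int.const_mul _) htsum_int, integral_const_mul, integral_haar_unitaryGroup_fin_exp_mul_trace_re,
    ← integral_tsum_of_summable_integral_norm hFint hsum]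
  simp_rw [hterm]
  rw [show (∑' n : ℕ, 1 / π ^ 2 * ((-1 : ℝ) ^ n / (n : ℝ) ^ 2) * (Matrix.of fun i j : Fin N => besselI ((i : ℤ) - (j : ℤ) + (n : ℤ)).natAbs β).det)
      = (∑' n : ℕ, 1 / π ^ 2 * ((-1 : ℝ) ^ n / (n : ℝ) ^ 2 * ((Matrix.of fun i j : Fin N => besselI ((i : ℤ) - (j : ℤ) + (n : ℤ)).natAbs β).det / (Matrix.of fun i j : Fin N => besselI ((i : ℤ) - (j : ℤ)).natAbs β).det))) * (Matrix.of fun i j : Fin N => besselI ((i : ℤ) - (j : ℤ)).natAbs β).det by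
    rw [← tsum_mul_right]; exact tsum_congr fun n => by field_simp]
  field_simp

/-! ### 4. Strong coupling: at `β = 0` the topological density is uniform, `⟨q_p²⟩_0 = 1/12` -/

/-- `I_n(0) = 0` for `n ≥ 1` (`∫_0^π cos(nθ) dθ = 0`). -/
theorem besselI_apply_zero_of_ne_zero {n : ℕ} (hn : n ≠ 0) : besselI n 0 = 0 := by
  rw [besselI]
  simp only [zero_mul, Real.exp_zero, one_mul]
  have hc : (n : ℝ) ≠ 0 := Nat.cast_ne_zero.2 hn
  have h := intervalIntegral.integral_comp_mul_left (fun θ : ℝ => Real.cos θ) (a := 0) (b := π) hc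
  simp only [mul_zero] at h
  rw [h, integral_cos, Real.sin_zero, sub_zero, Real.sin_nat_mul_pi, smul_zero, mul_zero]

/-- The shifted Bessel–Toeplitz determinants vanish at `β = 0`: `det[I_{|i−j+n|}(0)]_{N×N} = 0` for `n ≥ 1`, `N ≥ 1`
(the last row is zero). -/
theorem det_besselI_toeplitz_shift_zero (N : ℕ) [NeZero N] {n : ℕ} (hn : n ≠ 0) :
    (Matrix.of fun i j : Fin N => besselI ((i : ℤ) - (j : ℤ) + (n : ℤ)).natAbs 0).det = 0 := by
  have hN : 0 < N := Nat.pos_of_ne_zero (NeZero.ne N)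
  refine Matrix.det_eq_zero_of_row_eq_zero ⟨N - 1, Nat.sub_lt hN one_pos⟩ fun j => ?_
  rw [Matrix.of_apply]
  refine besselI_apply_zero_of_ne_zero ?_
  have hj : (j : ℕ) ≤ N - 1 := Nat.le_sub_one_of_lt j.2
  have h1 : (0 : ℤ) < ((⟨N - 1, Nat.sub_lt hN one_pos⟩ : Fin N) : ℤ) - (j : ℤ) + (n : ℤ) := by
    have : ((⟨N - 1, Nat.sub_lt hN one_pos⟩ : Fin N) : ℤ) = ((N - 1 : ℕ) : ℤ) := rfl
    rw [this]
    have hn1 : (1 : ℤ) ≤ n := by exact_mod_cast Nat.one_le_iff_ne_zero.2 hn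
    have hj' : ((j : ℕ) : ℤ) ≤ ((N - 1 : ℕ) : ℤ) := by exact_mod_cast hj
    have : (j : ℤ) = ((j : ℕ) : ℤ) := rfl
    omega
  intro h0
  have := Int.natAbs_eq_zero.1 h0
  omega

/-- **At `β = 0` (Haar measure) the topological angle is uniform: `⟨(arg det U_p/2π)²⟩_0 = 1/12`**, every `N ≥ 1`. -/
theorem unitary_topDensity_sq_zero (N : ℕ) [NeZero N] :
    (∫ u, (Complex.arg ((u : Matrix.unitaryGroup (Fin N) ℂ) : Matrix (Fin N) (Fin N) ℂ).det / (2 * π)) ^ 2 * Real.exp (-((0 : ℝ) * ((N : ℝ) - ((u : Matrix.unitaryGroup (Fin N) ℂ) : Matrix (Fin N) (Fin N) ℂ).trace.re))) ∂(haarProbability (Matrix.unitaryGroup (Fin N) ℂ)))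
      / (∫ u, Real.exp (-((0 : ℝ) * ((N : ℝ) - ((u : Matrix.unitaryGroup (Fin N) ℂ) : Matrix (Fin N) (Fin N) ℂ).trace.re))) ∂(haarProbability (Matrix.unitaryGroup (Fin N) ℂ))) = 1 / 12 := by
  rw [unitary_topDensity_sq_eq_tsum N 0]
  have hz : (fun n : ℕ => 1 / π ^ 2 * ((-1 : ℝ) ^ n / (n : ℝ) ^ 2 *
      ((Matrix.of fun i j : Fin N => besselI ((i : ℤ) - (j : ℤ) + (n : ℤ)).natAbs 0).det /
        (Matrix.of fun i j : Fin N => besselI ((i : ℤ) - (j : ℤ)).natAbs 0).det))) = fun _ => 0 := by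
    funext n
    rcases Nat.eq_zero_or_pos n with h0 | hpos
    · subst h0; simp
    · rw [det_besselI_toeplitz_shift_zero N (Nat.pos_iff_ne_zero.1 hpos)]; simp
  rw [hz, tsum_zero, add_zero]

end Summit.Ventures.LatticeQCDFlow.Scoring
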